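/-
Copyright (c) 2026 the pub-hodgecm-mathlib formalisation cell (harness21).  Prover seat hodgecm-mathlib-LH7-p06 (g2) (LH7 hand lent to L1; LEAD F0P6-plan (g14) BATCH #166 (2);
desk K2E3-p14 (g9)), Track B "K2-LIT" ∕ hLiu418 = stmt-HodgeConjecture-24832: U1-CT-ind stage 3 ("U1-glob"), brick B2b LEVEL 2, the `hN₃` producer — THE `U(2,2)_v` READING:
on the witnesses of ★ `K2LiuSingularWhittakerLocalReading.exists_twoStep_reading_of_forall_eq` BY VALUE, U1's finite clause and the Γ-letter give `N₃(½, ·) = 0`.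
THEOREMS ONLY (no `def`∕`instance`∕notation∕`sorry`).
-/
import Summits.HodgeConjecture.HodgeConjecture.Theorems.K2LiuLocalKernelN3OfGammaLetter        -- FILE A (this seat): `twistedStage_half_eq_zero` (brings ★ W-FE-3, ★ (K1a-3)-S, ★ F1)
import Summits.HodgeConjecture.HodgeConjecture.Theorems.K2LiuSingularWhittakerLocalReading      -- ★ p862989 (this seat): the structured reading whose witnesses we consume; brings the chain
import Summits.HodgeConjecture.HodgeConjecture.Theorems.K2LiuA7NormalisedRegularityNonsplitAllS0 -- ★ B7-all (K2Liu-p09): brings ★ `eq_aNorm_two_mul`, ★ `volume_inter_ne_zero`, ★ B4d-3, ★ B7-M2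
import Summits.HodgeConjecture.HodgeConjecture.Theorems.K2LiuRankOneWhittakerGammaLetterKw     -- ★ W-FE-4 (K2E3-p06): `exists_gammaLetter` — the Γ-letter at every finite place (ED. 2)
import HarnessLib

/-!
# Crux `HLiu418`, organ U1-CT-ind STAGE 3 ("U1-glob"), brick B2b LEVEL 2 — THE `hN₃` PRODUCER AT A FINITE NON-SPLIT PLACE:
# U1's finite clause (the normalised Siegel face dies at `½`) ⟹ the TWISTED two-step stage `N₃` of the structured local reading dies at `½`
# [KudlaRallis1994 §2; KudlaSweet1997 §1; Casselman1980 §3 Thm. 3.1; CasselmanShalika1980 §4; HarrisKudlaSweet1996 §6; GanTakeda2011SiegelWeil §7]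

Cell `hodgecm-mathlib`, crux item hLiu418 = `stmt-HodgeConjecture-24832`; squad K2, strike line L1, LEAD F0P6-plan (g14) BATCH #166 (2); desk K2E3-p14 (g9) (GO 00:00:08Z);
prover LH7-p06 (g2).  Lane `--supports stmt-HodgeConjecture-24832 --as helper` (count-neutral).

THE SLOT.  ★ LEVEL 1 `K2LiuLocalKernelResidueVanishesOfPlaceLetters` (K2E3-p14) takes per corner `hN₃ : ∀ q, N₃ (1/2) q = 0` for the twisted two-step stage `N₃` obtained from
★ `exists_twoStep_reading_of_forall_eq` (p862989).  LEVEL 2 does ONE `obtain ⟨A, N₁, N₂, N₃, κ, hA, hN₂reg, hN₃reg, _, _, _, htw, _, hstage, _⟩` on ★ p862989 and calls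
**`localKernelN3_half_eq_zero`** below with those witnesses BY VALUE, plus: the conductor letter `(cν, hνc)` of `χ_F`, the Γ-letter `(T, hT, Γt, N₀, hΓ, hΓreg, hΓ0)` BY
NAME-SHAPE (★ W-FE-2b `K2LiuTwistedGammaFactorLetter` unramified, ★ W-FE-2c `K2LiuTwistedGammaFactorLetterRamified` ramified, repackaged by K2E3-p06), and U1's FINITE
CLAUSE `hU1` in the bytes of the face of record ★ (A4′-R) `normalisedRegularity` (RULING M-157q (r3)):
  `∀ Fn, (∀ s, 1 < re s → ∀ h, M_v(s)(f s) h = aNorm 2 χ_v (νN(N_Δ ∩ K₀)) s · Fn s h) → (∀ h, s ↦ Fn s h regular at ½) → ∀ h, Fn ½ h = 0`.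

THE PROOF (`localKernelN3_half_eq_zero`).  (1) From the stage presentations (v) of ★ p862989 — `N₁ = L_F(2s+1)⁻¹·𝓐_{long} f`, `N₂ = L_{E_w}(2s)⁻¹·𝓑_w N₁` on `1 < re s` —
the two-step family `N₂` is right-`K′`-invariant for the uniform level `K′` of the flat family (★ `exists_uniform_level`) and satisfies the long-root `SL₂` relation with datum
`(C₀(s) = χ_s(φ t(−δ⁻¹,1))·∏‖δ_w‖, χ_F, e(s) = 2s)` (★ B7-CL `hrel_long_of_forall_eq`).  (2) STAGE C, UNTWISTED: ★ B7-S-all `exists_normalised_family_allS0` on THE SAME `N₂`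
gives `NC` with `∫ N₂ s (φ(w₂)u(x)g) dμ_F = L_F(2s−1)·NC s g`, regular everywhere.  (3) THE SIEGEL FACE over the same `N₂` (★ B7-all's three evaluations with (v) in place of
its own witnesses, ★ B4d-3 `integral_frameConj_weylSiegel_eq_iterated_of_chain`, ★ B7-M2 `chain_integrability_of_forall_eq`, ★ `eq_aNorm_two_mul`):
`M_v(s)(f s) h = aNorm(s) · Fn s h` with `Fn := vol⁻¹·b₂(s)·L_F(2s+1)·L_F(2s)·(χ_s(w_Δφ(w_S))·c_N·NC s h)`, regular at `½` (★ `isQRationalRegularAt_normalisedFactor_of_re_pos`);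
so `hU1` gives `Fn(½) = 0`, and the prefactor is non-zero at `½` (★ `bDen_two_ne_zero`, ★ `lF_ne_zero`, `χ_{½}(w_Δφ(w_S)) ≠ 0` by ★ `isUnit_detDelta`, `c_N > 0`):
**`NC(½, ·) = 0`**.  (4) THE WORD `ū(r)·φ(w₂)u(x′) = φ(w₂)u(x′ + d⁻¹r)` (`ū(r) = φ(w₂)u(rd⁻¹)φ(w₂)`, `w₂² = 1`, `u` additive), so `κ = d⁻¹`.  (5) FILE A
`twistedStage_half_eq_zero` at `Φ := N₂`, `N := N₃` ((iv) of ★ p862989), `NC`, `q₀ := q_v`: **`N₃(½, ·) = 0`**.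
References: [KudlaRallis1994] S. Kudla, S. Rallis, Ann. of Math. 140 (1994), §2; [KudlaSweet1997] S. Kudla, W. J. Sweet, Israel J. Math. 98 (1997), §1;
[Casselman1980] W. Casselman, Compositio Math. 40 (1980), §3 Thm. 3.1; [CasselmanShalika1980] W. Casselman, J. Shalika, Compositio Math. 41 (1980), §4;
[HarrisKudlaSweet1996] M. Harris, S. Kudla, W. J. Sweet, J. AMS 9 (1996), §6 (6.14)–(6.16); [GanTakeda2011SiegelWeil] W. T. Gan, S. Takeda (2011), §7 Lemma 7.4.
ED. 2 (`localKernelN3_half_eq_zero_of_record`, append-only).  ★ W-FE-4 `K2LiuRankOneWhittakerGammaLetterKw.exists_gammaLetter` (K2E3-p06) produces the Γ-letter in exactly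
FILE A's shape at every finite place; ED. 2 discharges it INSIDE (`T := C₀(s)·extend(χ_F⁻¹‖·‖^{−2s})`, `‖σd⁻¹‖ = q^{−j_c}`, `C₀` regular and non-zero at `½`, `e(½) = 1`), so the
socket LEVEL 2 consumes carries NO Γ binders: ★ p862989's binders + its witnesses by value + `(cν, hνc)` + `hU1` ⊢ `∀ h, N₃ (1/2) h = 0`.
HONEST LABEL.  Count-neutral helper: `HC_CM` is proved only modulo the 7 printed citations (2 remaining named inputs: hLiu418 = `stmt-HodgeConjecture-24832`,
h413 = `stmt-HodgeConjecture-24833`) until rung 0 closes; this file closes no socket — its output is LEVEL 1's `hN₃` hypothesis, modulo `hU1` (U1-glob).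
-/

set_option autoImplicit false
set_option linter.dupNamespace false -- the mandated namespace repeats `HodgeConjecture.HodgeConjecture`

noncomputable section

open scoped Classical NNReal ENNReal ComplexConjugate
open NumberField IsDedekindDomain Matrix MeasureTheory Topology
open Literature.NumberTheory.GaloisRepresentations.IsNonarchimedeanLocalField
open Literature.NumberTheory.Automorphic Literature.NumberTheory.Automorphic.UnitaryGroup
open Literature.NumberTheory.GelbartRogawski1991.AdaptedBlocks
open Literature.NumberTheory.GelbartRogawski1991.UnitaryDualPair.LocalSplitting
open Literature.NumberTheory.K2Lit.LocalSiegelDoubled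
open Summit.HodgeConjecture.HodgeConjecture.Cruxes.HLiu418.K2LiuQRationalDefs
open Summit.HodgeConjecture.HodgeConjecture.Cruxes.HLiu418.K2LiuQRationalLFactor
open Summit.HodgeConjecture.HodgeConjecture.Cruxes.HLiu418.K2LiuLocalLFactorDefs
open Summit.HodgeConjecture.HodgeConjecture.Cruxes.HLiu418.K2LiuLocalSiegelIwasawaFrame
open Summit.HodgeConjecture.HodgeConjecture.Cruxes.HLiu418.K2LiuLocalSiegelIwasawa
open Summit.HodgeConjecture.HodgeConjecture.Cruxes.HLiu418.K2LiuDoubledUTwoTwoBorelFrame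
open Summit.HodgeConjecture.HodgeConjecture.Cruxes.HLiu418.K2LiuDoubledUTwoTwoWeylCocycle
open Summit.HodgeConjecture.HodgeConjecture.Cruxes.HLiu418.K2LiuDoubledUTwoTwoLevi
open Summit.HodgeConjecture.HodgeConjecture.Cruxes.HLiu418.K2LiuDoubledUTwoTwoFrameTransport
open Summit.HodgeConjecture.HodgeConjecture.Cruxes.HLiu418.K2LiuDoubledUTwoTwoUnipotentCoordinates
open Summit.HodgeConjecture.HodgeConjecture.Cruxes.HLiu418.K2LiuDoubledUTwoTwoUnipotentHaar
open Summit.HodgeConjecture.HodgeConjecture.Cruxes.HLiu418.K2LiuDoubledUTwoTwoLeviTransport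
open Summit.HodgeConjecture.HodgeConjecture.Cruxes.HLiu418.K2LiuUnipDeltaRankOneCoordinates
open Summit.HodgeConjecture.HodgeConjecture.Cruxes.HLiu418.K2LiuSiegelCocycleLetters
open Summit.HodgeConjecture.HodgeConjecture.Cruxes.HLiu418.K2LiuSiegelCocycleStageLetters
open Summit.HodgeConjecture.HodgeConjecture.Cruxes.HLiu418.K2LiuSiegelCocycleStageShort
open Summit.HodgeConjecture.HodgeConjecture.Cruxes.HLiu418.K2LiuSiegelCocycleChainShort
open Summit.HodgeConjecture.HodgeConjecture.Cruxes.HLiu418.K2LiuSiegelCocycleChainLong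
open Summit.HodgeConjecture.HodgeConjecture.Cruxes.HLiu418.K2LiuSiegelIntertwiningCocycle
open Summit.HodgeConjecture.HodgeConjecture.Cruxes.HLiu418.K2LiuRankOneStage
open Summit.HodgeConjecture.HodgeConjecture.Cruxes.HLiu418.K2LiuFlatSiegelFamilies
open Summit.HodgeConjecture.HodgeConjecture.Cruxes.HLiu418.K2LiuLocalRingPlaceDecomposition
open Summit.HodgeConjecture.HodgeConjecture.Cruxes.HLiu418.K2LiuA7NormalisedRegularitySetup
open Summit.HodgeConjecture.HodgeConjecture.Cruxes.HLiu418.K2LiuA7NormalisedRegularityMajorant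
open Summit.HodgeConjecture.HodgeConjecture.Cruxes.HLiu418.K2LiuA7NormaliserAlgebra
open Summit.HodgeConjecture.HodgeConjecture.Cruxes.HLiu418.K2LiuA7NormalisedRegularityAllS0
open Summit.HodgeConjecture.HodgeConjecture.Cruxes.HLiu418.K2LiuLocalKernelN3OfGammaLetter (twistedStage_half_eq_zero)
open Summit.HodgeConjecture.HodgeConjecture.Cruxes.HLiu418.K2LiuRankOneWhittakerGammaLetterKw (exists_gammaLetter)

namespace Summit.HodgeConjecture.HodgeConjecture.Cruxes.HLiu418.K2LiuLocalKernelN3Reading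

variable (F : Type) [Field F] [NumberField F] (E : Type) [Field E] [NumberField E] [Algebra F E]
  [Algebra.IsQuadraticExtension F E] (c : E ≃ₐ[F] E)
  {δ : E} (hcδ : c δ = -δ) (hδ : δ ≠ 0) {d : F} (hd : δ * δ = algebraMap F E d) (v : HeightOneSpectrum (𝓞 F))
  {T₂ : Matrix (Fin 2) (Fin 2) F} (hT₂ : T₂.IsSymm) {J₂D : Matrix (Fin (2 + 2)) (Fin (2 + 2)) E} (hJ₂D : J₂D = (gramD F 2 T₂).map (algebraMap F E))
  (D Dinv : Matrix (Fin 2) (Fin 2) F) (hDD : D * Dinv = 1) (hDD' : Dinv * D = 1) (Q : GL (Fin (2 + 2)) F)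
  (hQm : (Q : Matrix (Fin (2 + 2)) (Fin (2 + 2)) F) = Matrix.reindex (e₂ 2) (e₂ 2) (Matrix.fromBlocks 1 D 1 (-D)))
  (hQ : (Q : Matrix (Fin (2 + 2)) (Fin (2 + 2)) F)ᵀ * gramD F 2 T₂ * (Q : Matrix (Fin (2 + 2)) (Fin (2 + 2)) F) = (StdForm.antidiagonal (2 + 2)).over F)

include hcδ hδ hd hT₂ hDD hQm hQ in
/-- **THE `hN₃` PRODUCER AT A FINITE NON-SPLIT PLACE.**  In the binders of ★ `exists_twoStep_reading_of_forall_eq` (p862989) and on ITS WITNESSES BY VALUE — the Levi letter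
`A`, the stage families `N₁ N₂ N₃` with (i) `N₂`, `N₃` regular everywhere, (iv) the twisted stage `N₃ s h = ∫ conj ψ(σx)·N₂ s (φ(w₂)u(x)h) dμ_F` and (v) the stage presentations
on `1 < re s` — together with the conductor letter `cν` of `χ_F`, the Γ-letter `(T, Γ̃, N₀)` of W-FE-2b∕2c BY NAME-SHAPE (`T_s(x) = C₀(s)χ_F(x)⁻¹‖x‖^{−2s}`, `C₀(s) = χ_s(φ t(−δ⁻¹,1))·∏‖δ_w‖`;
`∫_{x∉𝔭^M} T_s(x)ψ(σd⁻¹x⁻¹) dμ_F = L_F(2s−1)·Γ̃(s)` for `M ≥ N₀`, `1 < re s`; `Γ̃` regular and `≠ 0` at `½`) and U1's FINITE CLAUSE `hU1` (the normalised Siegel face of the flat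
family dies at `½`, bytes of ★ (A4′-R) `normalisedRegularity`): **`∀ h, N₃ (1/2) h = 0`** — LEVEL 1's `hN₃` at the corner.
[cite: KudlaRallis1994, §2] [cite: KudlaSweet1997, §1] [cite: Casselman1980, §3 Thm. 3.1] [cite: CasselmanShalika1980, §4] [cite: HarrisKudlaSweet1996, §6 (6.14)–(6.16)] -/
theorem localKernelN3_half_eq_zero
    [MeasurableSpace (unipDeltaLocal F E c v 2 (JD := J₂D))] [BorelSpace (unipDeltaLocal F E c v 2 (JD := J₂D))]
    (νN : Measure (unipDeltaLocal F E c v 2 (JD := J₂D))) [νN.IsHaarMeasure]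
    [MeasurableSpace (v.adicCompletion F)] [BorelSpace (v.adicCompletion F)] (μF : Measure (v.adicCompletion F)) [μF.IsAddHaarMeasure]
    (χv : ∀ w : PlacesOver E v, (w.1.adicCompletion E)ˣ →* ℂˣ) (hχ : ∀ (w' : PlacesOver E v) (x : (w'.1.adicCompletion E)ˣ), ‖((χv w' x : ℂˣ) : ℂ)‖ = 1)
    (K₀ : Subgroup (UnitaryGroup.localPi E c (2 + 2) J₂D v))
    (hK₀ : IsCompact (K₀ : Set (UnitaryGroup.localPi E c (2 + 2) J₂D v)) ∧ IsOpen (K₀ : Set (UnitaryGroup.localPi E c (2 + 2) J₂D v)))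
    (hIw : ∀ g : UnitaryGroup.localPi E c (2 + 2) J₂D v, ∃ p, IsSiegelDelta F E c hcδ hδ hd v 2 hT₂ hJ₂D p ∧ ∃ k ∈ K₀, g = p * k)
    (f : ℂ → UnitaryGroup.localPi E c (2 + 2) J₂D v → ℂ) (hSieg : ∀ s, IsLocalSiegelSection F E c hcδ hδ hd v 2 hT₂ hJ₂D χv s (f s)) (hsm : ∀ s, IsSmooth F E c v 2 (f s))
    (hflat : ∀ s s' : ℂ, ∀ k ∈ K₀, f s k = f s' k)
    (e3 : (v.adicCompletion F × UnitaryGroup.LocalRing E v × v.adicCompletion F) ≃ₜ unipDeltaLocal F E c v 2 (JD := J₂D))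
    (he3 : ∀ b₁ z b₂, ((e3 (b₁, z, b₂) : unipDeltaLocal F E c v 2 (JD := J₂D)) : UnitaryGroup.localPi E c (2 + 2) J₂D v) =
      FrameTransport.frameConj F E c v (2 + 2) hJ₂D (antidiagonal_over_eq_map F E 2) Q hQ
        (toLocalFour F E c v (nSiegel (UnitaryGroup.LocalRing E v) (UnitaryGroup.conjLocal E c v) (UnitaryGroup.conjLocal_conjLocal c v hcδ hδ)
          (UnitaryGroup.toLocalRing E v b₁ * algebraMap E (UnitaryGroup.LocalRing E v) δ) z
          (UnitaryGroup.toLocalRing E v b₂ * algebraMap E (UnitaryGroup.LocalRing E v) δ)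
          (conjLocal_coord F E c hcδ v b₁) (conjLocal_coord F E c hcδ v b₂))))
    (he3mul : ∀ p p', e3 (p + p') = e3 p * e3 p')
    (ψ : AddChar (v.adicCompletion F) Circle) (_hψ : Continuous ψ) {mψ : ℤ} (hmψ : ψ.HasConductorExp mψ) {σ : v.adicCompletion F} (hσ : σ ≠ 0)
    (w : PlacesOver E v) (hw : ∀ w' : PlacesOver E v, w' = w)
    [MeasurableSpace (w.1.adicCompletion E)] [BorelSpace (w.1.adicCompletion E)] (μw : Measure (w.1.adicCompletion E)) [μw.IsAddHaarMeasure]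
    -- ★ p862989's witnesses BY VALUE
    (A : GL (Fin 2) (UnitaryGroup.LocalRing E v)) (hA : A.val = !![1 - Pi.single w 1, Pi.single w 1; Pi.single w 1, 1 - Pi.single w 1])
    (N₁ N₂ N₃ : ℂ → UnitaryGroup.localPi E c (2 + 2) J₂D v → ℂ)
    (hN₂reg : ∀ (s₀ : ℂ) (g : UnitaryGroup.localPi E c (2 + 2) J₂D v), IsQRationalRegularAt (residueFieldCard (v.adicCompletion F)) s₀ fun s => N₂ s g)
    (hN₃reg : ∀ (s₀ : ℂ) (g : UnitaryGroup.localPi E c (2 + 2) J₂D v), IsQRationalRegularAt (residueFieldCard (v.adicCompletion F)) s₀ fun s => N₃ s g)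
    (htw : ∀ s : ℂ, 1 < s.re → ∀ h : UnitaryGroup.localPi E c (2 + 2) J₂D v,
      Integrable (fun x => conj ((ψ (σ * x) : ℂ)) * N₂ s (FrameTransport.frameConj F E c v (2 + 2) hJ₂D (antidiagonal_over_eq_map F E 2) Q hQ (toLocalFour F E c v (weylTwo (UnitaryGroup.LocalRing E v) (UnitaryGroup.conjLocal E c v))) * FrameTransport.frameConj F E c v (2 + 2) hJ₂D (antidiagonal_over_eq_map F E 2) Q hQ (toLocalFour F E c v (uLongTwo (UnitaryGroup.LocalRing E v) (UnitaryGroup.conjLocal E c v) (UnitaryGroup.toLocalRing E v x * algebraMap E (UnitaryGroup.LocalRing E v) δ) (conjLocal_coord F E c hcδ v x))) * h)) μF ∧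
        ∫ x, conj ((ψ (σ * x) : ℂ)) * N₂ s (FrameTransport.frameConj F E c v (2 + 2) hJ₂D (antidiagonal_over_eq_map F E 2) Q hQ (toLocalFour F E c v (weylTwo (UnitaryGroup.LocalRing E v) (UnitaryGroup.conjLocal E c v))) * FrameTransport.frameConj F E c v (2 + 2) hJ₂D (antidiagonal_over_eq_map F E 2) Q hQ (toLocalFour F E c v (uLongTwo (UnitaryGroup.LocalRing E v) (UnitaryGroup.conjLocal E c v) (UnitaryGroup.toLocalRing E v x * algebraMap E (UnitaryGroup.LocalRing E v) δ) (conjLocal_coord F E c hcδ v x))) * h) ∂μF = N₃ s h)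
    (hstage : ∀ s : ℂ, 1 < s.re →
      (∀ g : UnitaryGroup.localPi E c (2 + 2) J₂D v, N₁ s g = (lF F E v χv (2 * s + 1))⁻¹ * ∫ y, f s (FrameTransport.frameConj F E c v (2 + 2) hJ₂D (antidiagonal_over_eq_map F E 2) Q hQ (toLocalFour F E c v (weylTwo (UnitaryGroup.LocalRing E v) (UnitaryGroup.conjLocal E c v))) * FrameTransport.frameConj F E c v (2 + 2) hJ₂D (antidiagonal_over_eq_map F E 2) Q hQ (toLocalFour F E c v (uLongTwo (UnitaryGroup.LocalRing E v) (UnitaryGroup.conjLocal E c v) (UnitaryGroup.toLocalRing E v y * algebraMap E (UnitaryGroup.LocalRing E v) δ) (conjLocal_coord F E c hcδ v y))) * g) ∂μF) ∧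
      (∀ g : UnitaryGroup.localPi E c (2 + 2) J₂D v, N₂ s g = (lEN F E c v χv (2 * s))⁻¹ * ∫ ζ, N₁ s (FrameTransport.frameConj F E c v (2 + 2) hJ₂D (antidiagonal_over_eq_map F E 2) Q hQ (toLocalFour F E c v (leviElt (UnitaryGroup.LocalRing E v) (UnitaryGroup.conjLocal E c v) (UnitaryGroup.conjLocal_conjLocal c v hcδ hδ) A)) * FrameTransport.frameConj F E c v (2 + 2) hJ₂D (antidiagonal_over_eq_map F E 2) Q hQ (toLocalFour F E c v (uMinus (UnitaryGroup.LocalRing E v) (UnitaryGroup.conjLocal E c v) (UnitaryGroup.conjLocal_conjLocal c v hcδ hδ) (Pi.single w ζ))) * g) ∂μw))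
    -- the conductor letter of `χ_F`
    (cν : ℤ)
    (hνc : ∀ x : (v.adicCompletion F)ˣ, normAbs (v.adicCompletion F) (x : v.adicCompletion F) = 1 →
      (x : v.adicCompletion F) - 1 ∈ primePowBall (v.adicCompletion F) cν → chiF F E v χv x = 1)
    -- the Γ-letter BY NAME-SHAPE (★ W-FE-2b unramified ∕ ★ W-FE-2c ramified)
    (T : ℂ → v.adicCompletion F → ℂ)
    (hT : ∀ (s : ℂ) (x : (v.adicCompletion F)ˣ), T s x =
      localSiegelCharacter F E c v 2 χv s (FrameTransport.frameConj F E c v (2 + 2) hJ₂D (antidiagonal_over_eq_map F E 2) Q hQ (toLocalFour F E c v (torusElt (UnitaryGroup.LocalRing E v) (UnitaryGroup.conjLocal E c v) (UnitaryGroup.conjLocal_conjLocal c v hcδ hδ) (-((Units.mk0 δ hδ).map (algebraMap E (UnitaryGroup.LocalRing E v) : E →* UnitaryGroup.LocalRing E v))⁻¹) 1))) * ((∏ w' : PlacesOver E v, ‖algebraMap E (UnitaryGroup.LocalRing E v) δ w'‖ : ℝ) : ℂ) * (((chiF F E v χv x)⁻¹ : ℂˣ) : ℂ) * ((normAbs (v.adicCompletion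 F) (x : v.adicCompletion F) : ℝ) : ℂ) ^ (-(2 * s)))
    (Γt : ℂ → ℂ) (N₀ : ℤ)
    (hΓ : ∀ M : ℤ, N₀ ≤ M → ∀ s : ℂ, 1 < s.re →
      ∫ x in (primePowBall (v.adicCompletion F) M)ᶜ, T s x * ((ψ (σ * (((d⁻¹ : F) : v.adicCompletion F) * x⁻¹)) : ℂ)) ∂μF = lF F E v χv (2 * s - 1) * Γt s)
    (hΓreg : IsQRationalRegularAt (residueFieldCard (v.adicCompletion F)) (1 / 2) Γt) (hΓ0 : Γt (1 / 2) ≠ 0)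
    -- U1's finite clause at this family (RULING M-157q (r3); bytes of ★ (A4′-R) `normalisedRegularity`)
    (hU1 : ∀ Fn : ℂ → UnitaryGroup.localPi E c (2 + 2) J₂D v → ℂ,
      (∀ s : ℂ, 1 < s.re → ∀ h : UnitaryGroup.localPi E c (2 + 2) J₂D v,
        localIntertwining F E c v 2 hJ₂D νN (f s) h = aNorm F E c v 2 χv (νN.real {u | (u : UnitaryGroup.localPi E c (2 + 2) J₂D v) ∈ K₀}) s * Fn s h) →
      (∀ h : UnitaryGroup.localPi E c (2 + 2) J₂D v, IsQRationalRegularAt (residueFieldCard (v.adicCompletion F)) (1 / 2) (fun s => Fn s h)) →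
      ∀ h : UnitaryGroup.localPi E c (2 + 2) J₂D v, Fn (1 / 2) h = 0) :
    ∀ h : UnitaryGroup.localPi E c (2 + 2) J₂D v, N₃ (1 / 2) h = 0 := by
  -- topology and measures on `F_v`, `E_w`, `E ⊗ F_v`
  haveI := secondCountableTopology_adicCompletion F v
  haveI : ∀ w' : PlacesOver E v, SecondCountableTopology (w'.1.adicCompletion E) := fun w' => secondCountableTopology_adicCompletion E w'.1
  borelize (UnitaryGroup.LocalRing E v)
  obtain ⟨e₁, he₁, he₁add⟩ := exists_homeomorph_single_of_forall_eq F E v w hw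
  have hmap : Measure.map (⇑e₁) μw = Measure.map (⇑e₁.toMeasurableEquiv) μw := by rw [Homeomorph.toMeasurableEquiv_coe]
  haveI hμR : (Measure.map (⇑e₁) μw).IsAddHaarMeasure :=
    AddEquiv.isAddHaarMeasure_map μw ({ toFun := e₁, invFun := e₁.symm, left_inv := e₁.symm_apply_apply, right_inv := e₁.apply_symm_apply, map_add' := he₁add } :
      w.1.adicCompletion E ≃+ UnitaryGroup.LocalRing E v) e₁.continuous e₁.symm.continuous
  have hμRint : ∀ G : UnitaryGroup.LocalRing E v → ℂ, ∫ z, G z ∂(Measure.map (⇑e₁) μw) = ∫ ζ, G (Pi.single w ζ) ∂μw := fun G => by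
    rw [hmap, integral_map_equiv]; simp only [Homeomorph.toMeasurableEquiv_coe, he₁]
  -- the Haar relation on `N_Δ(F_v)` (a fresh scalar `cN`), one level for the whole family, the letters
  obtain ⟨cN, hcN, hν⟩ := exists_measure_eq_smul_map F E c v e3 he3mul νN μF (Measure.map (⇑e₁) μw)
  obtain ⟨K', -, hK'⟩ := exists_uniform_level F E c hcδ hδ hd v 2 hT₂ hJ₂D χv hSieg hflat hK₀.2 hIw (hsm 0)
  have huA := continuous_frameConj_uLongTwo_coord F E c hcδ hδ v hJ₂D Q hQ e3 he3
  have hūA := continuous_ubar F E c hcδ hδ hd v hJ₂D Q hQ e3 he3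
  have hmid : ∀ (ζ : w.1.adicCompletion E) (g : UnitaryGroup.localPi E c (2 + 2) J₂D v), FrameTransport.frameConj F E c v (2 + 2) hJ₂D (antidiagonal_over_eq_map F E 2) Q hQ (toLocalFour F E c v (weylOne (UnitaryGroup.LocalRing E v) (UnitaryGroup.conjLocal E c v))) * FrameTransport.frameConj F E c v (2 + 2) hJ₂D (antidiagonal_over_eq_map F E 2) Q hQ (toLocalFour F E c v (uMinus (UnitaryGroup.LocalRing E v) (UnitaryGroup.conjLocal E c v) (UnitaryGroup.conjLocal_conjLocal c v hcδ hδ) (Pi.single w ζ))) * g = FrameTransport.frameConj F E c v (2 + 2) hJ₂D (antidiagonal_over_eq_map F E 2) Q hQ (toLocalFour F E c v (leviElt (UnitaryGroup.LocalRing E v) (UnitaryGroup.conjLocal E c v) (UnitaryGroup.conjLocal_conjLocal c v hcδ hδ) A)) * FrameTransport.frameConj F E c v (2 + 2) hJ₂D (antidiagonal_over_eq_map F E 2) Q hQ (toLocalFour F E c v (uMinus (UnitaryGroup.LocalRing E v) (UnitaryGroup.conjLocal E c v) (UnitaryGroup.conjLocal_conjLocal c v hcδ hδ) (Pi.single w ζ)))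 * g := by
    intro ζ g
    rw [← frameConj_partialWeyl_mul_uMinus_of_forall_eq F E c hcδ hδ v hJ₂D Q hQ hw A hA (Pi.single w ζ), Pi.single_eq_same]
  have hq0 : residueFieldCard (v.adicCompletion F) ≠ 0 := residueFieldCard_ne_zero _
  have hq2 : 2 ≤ residueFieldCard (v.adicCompletion F) := one_lt_residueFieldCard (v.adicCompletion F)
  -- the numerators do not vanish on the half-plane
  have hLA : ∀ s : ℂ, 1 < s.re → lF F E v χv (2 * s + 1) ≠ 0 := fun s hs =>
    lF_ne_zero hχ (by simp only [Complex.add_re, Complex.mul_re, Complex.re_ofNat, Complex.im_ofNat, Complex.one_re]; linarith)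
  have hLB : ∀ s : ℂ, 1 < s.re → lEN F E c v χv (2 * s) ≠ 0 := fun s hs =>
    lEN_ne_zero c χv hχ (by simp only [Complex.mul_re, Complex.re_ofNat, Complex.im_ofNat]; linarith)
  -- (v) as integral identities
  have hI₁ : ∀ s : ℂ, 1 < s.re → ∀ g : UnitaryGroup.localPi E c (2 + 2) J₂D v, ∫ y, f s (FrameTransport.frameConj F E c v (2 + 2) hJ₂D (antidiagonal_over_eq_map F E 2) Q hQ (toLocalFour F E c v (weylTwo (UnitaryGroup.LocalRing E v) (UnitaryGroup.conjLocal E c v))) * FrameTransport.frameConj F E c v (2 + 2) hJ₂D (antidiagonal_over_eq_map F E 2) Q hQ (toLocalFour F E c v (uLongTwo (UnitaryGroup.LocalRing E v) (UnitaryGroup.conjLocal E c v) (UnitaryGroup.toLocalRing E v y * algebraMap E (UnitaryGroup.LocalRing E v) δ) (conjLocal_coord F E c hcδ v y))) * g) ∂μF = lF F E v χv (2 * s + 1) * N₁ s g := fun s hs g => by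
    rw [(hstage s hs).1 g, ← mul_assoc, mul_inv_cancel₀ (hLA s hs), one_mul]
  have hI₂ : ∀ s : ℂ, 1 < s.re → ∀ g : UnitaryGroup.localPi E c (2 + 2) J₂D v, ∫ ζ, N₁ s (FrameTransport.frameConj F E c v (2 + 2) hJ₂D (antidiagonal_over_eq_map F E 2) Q hQ (toLocalFour F E c v (leviElt (UnitaryGroup.LocalRing E v) (UnitaryGroup.conjLocal E c v) (UnitaryGroup.conjLocal_conjLocal c v hcδ hδ) A)) * FrameTransport.frameConj F E c v (2 + 2) hJ₂D (antidiagonal_over_eq_map F E 2) Q hQ (toLocalFour F E c v (uMinus (UnitaryGroup.LocalRing E v) (UnitaryGroup.conjLocal E c v) (UnitaryGroup.conjLocal_conjLocal c v hcδ hδ) (Pi.single w ζ))) * g) ∂μw = lEN F E c v χv (2 * s) * N₂ s g := fun s hs g => by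
    rw [(hstage s hs).2 g, ← mul_assoc, mul_inv_cancel₀ (hLB s hs), one_mul]
  -- `N₁`, `N₂` are right-`K′`-invariant on the half-plane
  have hN₁K : ∀ s : ℂ, 1 < s.re → ∀ g, ∀ k ∈ (K' : Subgroup (UnitaryGroup.localPi E c (2 + 2) J₂D v)), N₁ s (g * k) = N₁ s g := fun s hs g k hk => by
    rw [(hstage s hs).1, (hstage s hs).1]
    exact congrArg _ (integral_congr_ae (Filter.Eventually.of_forall fun y => by simp only [← mul_assoc]; exact hK' s _ k hk))
  have hN₂K : ∀ s : ℂ, 1 < s.re → ∀ g, ∀ k ∈ (K' : Subgroup (UnitaryGroup.localPi E c (2 + 2) J₂D v)), N₂ s (g * k) = N₂ s g := fun s hs g k hk => by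
    rw [(hstage s hs).2, (hstage s hs).2]
    exact congrArg _ (integral_congr_ae (Filter.Eventually.of_forall fun ζ => by simp only [← mul_assoc]; exact hN₁K s hs _ k hk))
  -- the long-root `SL₂` relation of `N₂` (★ B7-CL), datum `(C₀(s), χ_F, e(s) = 2s)`
  have heC : ∀ s : ℂ, 1 < s.re → 1 < (((2 : ℕ) : ℂ) * s + 0).re := fun s hs => by simp; linarith
  have hrelC : ∀ s : ℂ, 1 < s.re → ∀ (x : (v.adicCompletion F)ˣ) (g : UnitaryGroup.localPi E c (2 + 2) J₂D v),
      N₂ s (FrameTransport.frameConj F E c v (2 + 2) hJ₂D (antidiagonal_over_eq_map F E 2) Q hQ (toLocalFour F E c v (weylTwo (UnitaryGroup.LocalRing E v) (UnitaryGroup.conjLocal E c v))) * FrameTransport.frameConj F E c v (2 + 2) hJ₂D (antidiagonal_over_eq_map F E 2) Q hQ (toLocalFour F E c v (uLongTwo (UnitaryGroup.LocalRing E v) (UnitaryGroup.conjLocal E c v) (UnitaryGroup.toLocalRing E v (x : v.adicCompletion F) * algebraMap E (UnitaryGroup.LocalRing E v) δ) (conjLocal_coord F E c hcδ v (x : v.adicCompletion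 F)))) * g) =
        (fun s => localSiegelCharacter F E c v 2 χv s (FrameTransport.frameConj F E c v (2 + 2) hJ₂D (antidiagonal_over_eq_map F E 2) Q hQ (toLocalFour F E c v (torusElt (UnitaryGroup.LocalRing E v) (UnitaryGroup.conjLocal E c v) (UnitaryGroup.conjLocal_conjLocal c v hcδ hδ) (-((Units.mk0 δ hδ).map (algebraMap E (UnitaryGroup.LocalRing E v) : E →* UnitaryGroup.LocalRing E v))⁻¹) 1))) * ((∏ w' : PlacesOver E v, ‖algebraMap E (UnitaryGroup.LocalRing E v) δ w'‖ : ℝ) : ℂ)) s * (((chiF F E v χv x)⁻¹ : ℂˣ) : ℂ) * ((normAbs (v.adicCompletion F) (x : v.adicCompletion F) : ℝ) : ℂ) ^ (-(((2 : ℕ) : ℂ) * s + 0)) *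
          N₂ s (FrameTransport.frameConj F E c v (2 + 2) hJ₂D (antidiagonal_over_eq_map F E 2) Q hQ (toLocalFour F E c v (weylTwo (UnitaryGroup.LocalRing E v) (UnitaryGroup.conjLocal E c v))) * FrameTransport.frameConj F E c v (2 + 2) hJ₂D (antidiagonal_over_eq_map F E 2) Q hQ (toLocalFour F E c v (uLongTwo (UnitaryGroup.LocalRing E v) (UnitaryGroup.conjLocal E c v) (UnitaryGroup.toLocalRing E v ((x⁻¹ : (v.adicCompletion F)ˣ) : v.adicCompletion F) * algebraMap E (UnitaryGroup.LocalRing E v) δ⁻¹) (conjLocal_coord_inv F E c hcδ v ((x⁻¹ : (v.adicCompletion F)ˣ) : v.adicCompletion F)))) * FrameTransport.frameConj F E c v (2 + 2) hJ₂D (antidiagonal_over_eq_map F E 2) Q hQ (toLocalFour F E c v (weylTwo (UnitaryGroup.LocalRing E v) (UnitaryGroup.conjLocal E c v))) * g) := fun s hs x g => by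
    rw [hrel_long_of_forall_eq F E c hcδ hδ hd v hT₂ hJ₂D D Dinv hDD Q hQm hQ μF χv s (hSieg s) _ (hstage s hs).1 w hw μw A hA _ (hstage s hs).2 x g]
    simp only [Nat.cast_ofNat, add_zero]; ring
  -- STAGE C, UNTWISTED: `N₂ ↦ NC`, numerator `L_F(2s−1, χ_F)`, on THE SAME `N₂` (★ B7-S-all)
  obtain ⟨NC, hNCreg₀, hNC⟩ := exists_normalised_family_allS0 μF N₂ K'.isOpen hN₂K huA
    (frameConj_uLongTwo_coord_zero F E c hcδ v hJ₂D Q hQ) hūA (ubar_zero F E c hcδ hδ hd v hJ₂D Q hQ) (frameConj_uLongTwo_coord_add F E c hcδ v hJ₂D Q hQ)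
    (FrameTransport.frameConj F E c v (2 + 2) hJ₂D (antidiagonal_over_eq_map F E 2) Q hQ (toLocalFour F E c v (weylTwo (UnitaryGroup.LocalRing E v) (UnitaryGroup.conjLocal E c v)))) (chiF F E v χv) (norm_chiF_eq_one (F := F) (E := E) hχ) 2 0 heC
    (fun s => localSiegelCharacter F E c v 2 χv s (FrameTransport.frameConj F E c v (2 + 2) hJ₂D (antidiagonal_over_eq_map F E 2) Q hQ (toLocalFour F E c v (torusElt (UnitaryGroup.LocalRing E v) (UnitaryGroup.conjLocal E c v) (UnitaryGroup.conjLocal_conjLocal c v hcδ hδ) (-((Units.mk0 δ hδ).map (algebraMap E (UnitaryGroup.LocalRing E v) : E →* UnitaryGroup.LocalRing E v))⁻¹) 1))) * ((∏ w' : PlacesOver E v, ‖algebraMap E (UnitaryGroup.LocalRing E v) δ w'‖ : ℝ) : ℂ)) (residueFieldCard (v.adicCompletion F)) 1 hq0 (pow_one _).symm hrelC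
  have hNCreg : ∀ (s₀ : ℂ) (g), IsQRationalRegularAt (residueFieldCard (v.adicCompletion F)) s₀ fun s => NC s g := fun s₀ =>
    hNCreg₀ s₀ ((isQRationalRegularAt_localSiegelCharacter F E c hcδ hδ hd v 2 hT₂ hJ₂D χv
      (isSiegelDelta_frameConj_torusElt F E c hcδ hδ hd v hT₂ hJ₂D D Dinv hDD Q hQm hQ _ 1) s₀).mul (isQRationalRegularAt_const _ _ _)) (hN₂reg s₀)
  -- the volume factor and the Levi shift `m₀ = w_Δ φ(w_S)`
  have hvol := volume_inter_ne_zero F E c v 2 νN K₀ hK₀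
  have hm₀ := isSiegelDelta_weylDelta_mul_frameConj_weylSiegel F E c hcδ hδ hd v hT₂ hJ₂D D Dinv hDD Q hQm hQ
  -- THE SIEGEL FACE over the same `N₂`: `M_v(s)(f s) h = aNorm(s) · Fn s h` (★ B7-all's three evaluations, with (v))
  have hface : ∀ s : ℂ, 1 < s.re → ∀ h : UnitaryGroup.localPi E c (2 + 2) J₂D v, localIntertwining F E c v 2 hJ₂D νN (f s) h =
      aNorm F E c v 2 χv (νN.real {u | (u : UnitaryGroup.localPi E c (2 + 2) J₂D v) ∈ K₀}) s *
        (((νN.real {u | (u : UnitaryGroup.localPi E c (2 + 2) J₂D v) ∈ K₀} : ℝ) : ℂ)⁻¹ * bDen F E c v 2 χv s * lF F E v χv (2 * s + 1) * lF F E v χv (2 * s) *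
          (localSiegelCharacter F E c v 2 χv s (weylDelta F E c v 2 hJ₂D (T₀ := T₂) * FrameTransport.frameConj F E c v (2 + 2) hJ₂D (antidiagonal_over_eq_map F E 2) Q hQ (toLocalFour F E c v (weylSiegel (UnitaryGroup.LocalRing E v) (UnitaryGroup.conjLocal E c v)))) * ((cN : ℝ) : ℂ) * NC s h)) := by
    intro s hs h
    have hs0 : 0 < s.re := by linarith
    have hch := chain_integrability_of_forall_eq F E c hcδ hδ hd v hT₂ hJ₂D D Dinv hDD Q hQm hQ μF e3 he3 hχ hs (hSieg s) (hsm s) K' (hK' s) w hw μw e₁ he₁ A hA h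
    rw [localIntertwining_eq_mul_integral_frameConj F E c hcδ hδ hd v hT₂ hJ₂D D Dinv hDD Q hQm hQ νN χv s (hSieg s) h,
      (integral_frameConj_weylSiegel_eq_iterated_of_chain F E c hcδ hδ v hJ₂D Q hQ e3 he3 νN μF (Measure.map (⇑e₁) μw) cN hν (f s) h
        hch.1 hch.2.1 hch.2.2.1 hch.2.2.2).2]
    have inner : ∀ (x : v.adicCompletion F) (z : UnitaryGroup.LocalRing E v),
        ∫ y, f s (FrameTransport.frameConj F E c v (2 + 2) hJ₂D (antidiagonal_over_eq_map F E 2) Q hQ (toLocalFour F E c v (weylTwo (UnitaryGroup.LocalRing E v) (UnitaryGroup.conjLocal E c v))) * FrameTransport.frameConj F E c v (2 + 2) hJ₂D (antidiagonal_over_eq_map F E 2) Q hQ (toLocalFour F E c v (uLongTwo (UnitaryGroup.LocalRing E v) (UnitaryGroup.conjLocal E c v) (UnitaryGroup.toLocalRing E v y * algebraMap E (UnitaryGroup.LocalRing E v) δ) (conjLocal_coord F E c hcδ v y))) * (FrameTransport.frameConj F E c v (2 + 2) hJ₂D (antidiagonal_over_eq_map F E 2) Q hQ (toLocalFour F E c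 v (weylOne (UnitaryGroup.LocalRing E v) (UnitaryGroup.conjLocal E c v))) * FrameTransport.frameConj F E c v (2 + 2) hJ₂D (antidiagonal_over_eq_map F E 2) Q hQ (toLocalFour F E c v (uMinus (UnitaryGroup.LocalRing E v) (UnitaryGroup.conjLocal E c v) (UnitaryGroup.conjLocal_conjLocal c v hcδ hδ) z)) * (FrameTransport.frameConj F E c v (2 + 2) hJ₂D (antidiagonal_over_eq_map F E 2) Q hQ (toLocalFour F E c v (weylTwo (UnitaryGroup.LocalRing E v) (UnitaryGroup.conjLocal E c v))) * FrameTransport.frameConj F E c v (2 + 2) hJ₂D (antidiagonal_over_eq_map F E 2) Q hQ (toLocalFour F E c v (uLongTwo (UnitaryGroup.LocalRing E v) (UnitaryGroup.conjLocal E c v) (UnitaryGroup.toLocalRing E v x * algebraMap E (UnitaryGroup.LocalRing E v) δ) (conjLocal_coord F E c hcδ v x))) * h))) ∂μF = lF F E v χv (2 * s + 1) * N₁ s (FrameTransport.frameConj F E c v (2 + 2) hJ₂D (antidiagonal_over_eq_map F E 2) Q hQ (toLocalFour F E c v (weylOne (UnitaryGroup.LocalRing E v) (UnitaryGroup.conjLocal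 E c v))) * FrameTransport.frameConj F E c v (2 + 2) hJ₂D (antidiagonal_over_eq_map F E 2) Q hQ (toLocalFour F E c v (uMinus (UnitaryGroup.LocalRing E v) (UnitaryGroup.conjLocal E c v) (UnitaryGroup.conjLocal_conjLocal c v hcδ hδ) z)) * (FrameTransport.frameConj F E c v (2 + 2) hJ₂D (antidiagonal_over_eq_map F E 2) Q hQ (toLocalFour F E c v (weylTwo (UnitaryGroup.LocalRing E v) (UnitaryGroup.conjLocal E c v))) * FrameTransport.frameConj F E c v (2 + 2) hJ₂D (antidiagonal_over_eq_map F E 2) Q hQ (toLocalFour F E c v (uLongTwo (UnitaryGroup.LocalRing E v) (UnitaryGroup.conjLocal E c v) (UnitaryGroup.toLocalRing E v x * algebraMap E (UnitaryGroup.LocalRing E v) δ) (conjLocal_coord F E c hcδ v x))) * h)) :=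
      fun x z => hI₁ s hs _
    have middle : ∀ x : v.adicCompletion F,
        ∫ z, lF F E v χv (2 * s + 1) * N₁ s (FrameTransport.frameConj F E c v (2 + 2) hJ₂D (antidiagonal_over_eq_map F E 2) Q hQ (toLocalFour F E c v (weylOne (UnitaryGroup.LocalRing E v) (UnitaryGroup.conjLocal E c v))) * FrameTransport.frameConj F E c v (2 + 2) hJ₂D (antidiagonal_over_eq_map F E 2) Q hQ (toLocalFour F E c v (uMinus (UnitaryGroup.LocalRing E v) (UnitaryGroup.conjLocal E c v) (UnitaryGroup.conjLocal_conjLocal c v hcδ hδ) z)) * (FrameTransport.frameConj F E c v (2 + 2) hJ₂D (antidiagonal_over_eq_map F E 2) Q hQ (toLocalFour F E c v (weylTwo (UnitaryGroup.LocalRing E v) (UnitaryGroup.conjLocal E c v))) * FrameTransport.frameConj F E c v (2 + 2) hJ₂D (antidiagonal_over_eq_map F E 2) Q hQ (toLocalFour F E c v (uLongTwo (UnitaryGroup.LocalRing E v) (UnitaryGroup.conjLocal E c v) (UnitaryGroup.toLocalRing E v x * algebraMap E (UnitaryGroup.LocalRing E v) δ) (conjLocal_coord F E c hcδ v x))) *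 h)) ∂(Measure.map (⇑e₁) μw) =
          lF F E v χv (2 * s + 1) * (lEN F E c v χv (2 * s) * N₂ s (FrameTransport.frameConj F E c v (2 + 2) hJ₂D (antidiagonal_over_eq_map F E 2) Q hQ (toLocalFour F E c v (weylTwo (UnitaryGroup.LocalRing E v) (UnitaryGroup.conjLocal E c v))) * FrameTransport.frameConj F E c v (2 + 2) hJ₂D (antidiagonal_over_eq_map F E 2) Q hQ (toLocalFour F E c v (uLongTwo (UnitaryGroup.LocalRing E v) (UnitaryGroup.conjLocal E c v) (UnitaryGroup.toLocalRing E v x * algebraMap E (UnitaryGroup.LocalRing E v) δ) (conjLocal_coord F E c hcδ v x))) * h)) := fun x => by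
      rw [hμRint, integral_const_mul]
      simp only [hmid]
      rw [hI₂ s hs]
    have outer : ∫ x, lF F E v χv (2 * s + 1) * (lEN F E c v χv (2 * s) * N₂ s (FrameTransport.frameConj F E c v (2 + 2) hJ₂D (antidiagonal_over_eq_map F E 2) Q hQ (toLocalFour F E c v (weylTwo (UnitaryGroup.LocalRing E v) (UnitaryGroup.conjLocal E c v))) * FrameTransport.frameConj F E c v (2 + 2) hJ₂D (antidiagonal_over_eq_map F E 2) Q hQ (toLocalFour F E c v (uLongTwo (UnitaryGroup.LocalRing E v) (UnitaryGroup.conjLocal E c v) (UnitaryGroup.toLocalRing E v x * algebraMap E (UnitaryGroup.LocalRing E v) δ) (conjLocal_coord F E c hcδ v x))) * h)) ∂μF =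
        lF F E v χv (2 * s + 1) * (lEN F E c v χv (2 * s) * (lFactor F v (chiF F E v χv) (((2 : ℕ) : ℂ) * s + 0 - 1) * NC s h)) := by
      rw [integral_const_mul, integral_const_mul, (hNC s hs h).2]
    simp_rw [inner, middle]
    rw [outer]
    have hL3 : lFactor F v (chiF F E v χv) (((2 : ℕ) : ℂ) * s + 0 - 1) = lF F E v χv (2 * s - 1) := by
      rw [lF]; congr 1; push_cast; ring
    rw [hL3]
    have key := eq_aNorm_two_mul (c := c) (χv := χv) hχ hvol hs0 (localSiegelCharacter F E c v 2 χv s (weylDelta F E c v 2 hJ₂D (T₀ := T₂) * FrameTransport.frameConj F E c v (2 + 2) hJ₂D (antidiagonal_over_eq_map F E 2) Q hQ (toLocalFour F E c v (weylSiegel (UnitaryGroup.LocalRing E v) (UnitaryGroup.conjLocal E c v)))) * ((cN : ℝ) : ℂ)) (NC s h)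
    calc _ = localSiegelCharacter F E c v 2 χv s (weylDelta F E c v 2 hJ₂D (T₀ := T₂) * FrameTransport.frameConj F E c v (2 + 2) hJ₂D (antidiagonal_over_eq_map F E 2) Q hQ (toLocalFour F E c v (weylSiegel (UnitaryGroup.LocalRing E v) (UnitaryGroup.conjLocal E c v)))) * ((cN : ℝ) : ℂ) * lF F E v χv (2 * s + 1) * lEN F E c v χv (2 * s) * lF F E v χv (2 * s - 1) * NC s h := by ring
      _ = _ := key
  -- U1's finite clause kills the third stage at `½`
  have hNC0 : ∀ g : UnitaryGroup.localPi E c (2 + 2) J₂D v, NC (1 / 2) g = 0 := by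
    have hFn0 := hU1 _ hface fun h => isQRationalRegularAt_normalisedFactor_of_re_pos (c := c) (χv := χv) hχ _ (by norm_num)
      (((isQRationalRegularAt_localSiegelCharacter F E c hcδ hδ hd v 2 hT₂ hJ₂D χv hm₀ (1 / 2)).mul (isQRationalRegularAt_const _ _ _)).mul (hNCreg (1 / 2) h))
    intro g
    have h0 := hFn0 g
    have hpre : ((νN.real {u | (u : UnitaryGroup.localPi E c (2 + 2) J₂D v) ∈ K₀} : ℝ) : ℂ)⁻¹ * bDen F E c v 2 χv (1 / 2) * lF F E v χv (2 * (1 / 2) + 1) * lF F E v χv (2 * (1 / 2)) ≠ 0 :=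
      mul_ne_zero (mul_ne_zero (mul_ne_zero (inv_ne_zero (Complex.ofReal_ne_zero.2 hvol)) (bDen_two_ne_zero c χv hχ (by norm_num)))
        (lF_ne_zero hχ (by norm_num))) (lF_ne_zero hχ (by norm_num))
    have hpos : 0 < absDetDelta F E c v 2 (weylDelta F E c v 2 hJ₂D (T₀ := T₂) * FrameTransport.frameConj F E c v (2 + 2) hJ₂D (antidiagonal_over_eq_map F E 2) Q hQ (toLocalFour F E c v (weylSiegel (UnitaryGroup.LocalRing E v) (UnitaryGroup.conjLocal E c v)))) :=
      Finset.prod_pos fun w' _ => norm_pos_iff.2 (K2LiuLocalSiegel.isUnit_detDelta F E c hcδ hδ hd v 2 hT₂ hJ₂D _ hm₀ w').ne_zero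
    have hχ0 : localSiegelCharacter F E c v 2 χv (1 / 2) (weylDelta F E c v 2 hJ₂D (T₀ := T₂) * FrameTransport.frameConj F E c v (2 + 2) hJ₂D (antidiagonal_over_eq_map F E 2) Q hQ (toLocalFour F E c v (weylSiegel (UnitaryGroup.LocalRing E v) (UnitaryGroup.conjLocal E c v)))) * ((cN : ℝ) : ℂ) ≠ 0 := by
      refine mul_ne_zero ?_ (Complex.ofReal_ne_zero.2 (NNReal.coe_pos.2 hcN).ne')
      unfold localSiegelCharacter
      exact mul_ne_zero (Units.ne_zero _) (Complex.cpow_ne_zero_iff.2 (Or.inl (Complex.ofReal_ne_zero.2 hpos.ne')))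
    exact (mul_eq_zero.1 ((mul_eq_zero.1 h0).resolve_left hpre)).resolve_left hχ0
  -- THE WORD: `ū(r) · φ(w₂)u(x′) = φ(w₂)u(x′ + d⁻¹r)`, so `κ = d⁻¹ ≠ 0`
  have hd0 : (d : F) ≠ 0 := by
    intro h0
    apply mul_ne_zero hδ hδ
    rw [hd, h0, map_zero]
  have hκ0 : ((d⁻¹ : F) : v.adicCompletion F) ≠ 0 := by
    rw [show ((d⁻¹ : F) : v.adicCompletion F) = algebraMap F (v.adicCompletion F) (d⁻¹ : F) from rfl]
    exact (map_ne_zero _).2 (inv_ne_zero hd0)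
  have hw2 : ∀ g : UnitaryGroup.localPi E c (2 + 2) J₂D v, FrameTransport.frameConj F E c v (2 + 2) hJ₂D (antidiagonal_over_eq_map F E 2) Q hQ (toLocalFour F E c v (weylTwo (UnitaryGroup.LocalRing E v) (UnitaryGroup.conjLocal E c v))) * (FrameTransport.frameConj F E c v (2 + 2) hJ₂D (antidiagonal_over_eq_map F E 2) Q hQ (toLocalFour F E c v (weylTwo (UnitaryGroup.LocalRing E v) (UnitaryGroup.conjLocal E c v))) * g) = g := fun g => by
    rw [← mul_assoc, ← map_mul, ← map_mul, weylTwo_mul_weylTwo, map_one, map_one, one_mul]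
  have hword : ∀ r x' : v.adicCompletion F, FrameTransport.frameConj F E c v (2 + 2) hJ₂D (antidiagonal_over_eq_map F E 2) Q hQ (toLocalFour F E c v (weylTwo (UnitaryGroup.LocalRing E v) (UnitaryGroup.conjLocal E c v))) * FrameTransport.frameConj F E c v (2 + 2) hJ₂D (antidiagonal_over_eq_map F E 2) Q hQ (toLocalFour F E c v (uLongTwo (UnitaryGroup.LocalRing E v) (UnitaryGroup.conjLocal E c v) (UnitaryGroup.toLocalRing E v r * algebraMap E (UnitaryGroup.LocalRing E v) δ⁻¹) (conjLocal_coord_inv F E c hcδ v r))) * FrameTransport.frameConj F E c v (2 + 2) hJ₂D (antidiagonal_over_eq_map F E 2) Q hQ (toLocalFour F E c v (weylTwo (UnitaryGroup.LocalRing E v) (UnitaryGroup.conjLocal E c v))) * (FrameTransport.frameConj F E c v (2 + 2) hJ₂D (antidiagonal_over_eq_map F E 2) Q hQ (toLocalFour F E c v (weylTwo (UnitaryGroup.LocalRing E v) (UnitaryGroup.conjLocal E c v))) * FrameTransport.frameConj F E c v (2 + 2) hJ₂D (antidiagonal_over_eq_map F E 2) Q hQ (toLocalFour F E c v (uLongTwo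 (UnitaryGroup.LocalRing E v) (UnitaryGroup.conjLocal E c v) (UnitaryGroup.toLocalRing E v x' * algebraMap E (UnitaryGroup.LocalRing E v) δ) (conjLocal_coord F E c hcδ v x')))) = FrameTransport.frameConj F E c v (2 + 2) hJ₂D (antidiagonal_over_eq_map F E 2) Q hQ (toLocalFour F E c v (weylTwo (UnitaryGroup.LocalRing E v) (UnitaryGroup.conjLocal E c v))) * FrameTransport.frameConj F E c v (2 + 2) hJ₂D (antidiagonal_over_eq_map F E 2) Q hQ (toLocalFour F E c v (uLongTwo (UnitaryGroup.LocalRing E v) (UnitaryGroup.conjLocal E c v) (UnitaryGroup.toLocalRing E v (x' + ((d⁻¹ : F) : v.adicCompletion F) * r) * algebraMap E (UnitaryGroup.LocalRing E v) δ) (conjLocal_coord F E c hcδ v (x' + ((d⁻¹ : F) : v.adicCompletion F) * r)))) := by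
    intro r x'
    rw [frameConj_uLongTwo_coord_inv_eq F E c hcδ hδ hd v hJ₂D Q hQ r]
    simp only [mul_assoc, hw2]
    rw [← frameConj_uLongTwo_coord_add F E c hcδ v hJ₂D Q hQ,
      uLongTwo_congr F E c v _ (conjLocal_coord F E c hcδ v (x' + ((d⁻¹ : F) : v.adicCompletion F) * r)) (by rw [show r * ((d⁻¹ : F) : v.adicCompletion F) + x' = x' + ((d⁻¹ : F) : v.adicCompletion F) * r by ring])]
  -- the Γ-letter and the kernel in FILE A's currency (`e(s) = 2s + 0`)
  have hL3' : ∀ s : ℂ, lF F E v χv (2 * s - 1) = lFactor F v (chiF F E v χv) (((2 : ℕ) : ℂ) * s + 0 - 1) := fun s => by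
    rw [lF]; congr 1; push_cast; ring
  have hT' : ∀ (s : ℂ) (x : (v.adicCompletion F)ˣ), T s x =
      (fun s => localSiegelCharacter F E c v 2 χv s (FrameTransport.frameConj F E c v (2 + 2) hJ₂D (antidiagonal_over_eq_map F E 2) Q hQ (toLocalFour F E c v (torusElt (UnitaryGroup.LocalRing E v) (UnitaryGroup.conjLocal E c v) (UnitaryGroup.conjLocal_conjLocal c v hcδ hδ) (-((Units.mk0 δ hδ).map (algebraMap E (UnitaryGroup.LocalRing E v) : E →* UnitaryGroup.LocalRing E v))⁻¹) 1))) * ((∏ w' : PlacesOver E v, ‖algebraMap E (UnitaryGroup.LocalRing E v) δ w'‖ : ℝ) : ℂ)) s * (((chiF F E v χv x)⁻¹ : ℂˣ) : ℂ) * ((normAbs (v.adicCompletion F) (x : v.adicCompletion F) : ℝ) : ℂ) ^ (-(((2 : ℕ) : ℂ) * s + 0)) :=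
    fun s x => by simp only [Nat.cast_ofNat, add_zero]; exact hT s x
  have hΓ' : ∀ M : ℤ, N₀ ≤ M → ∀ s : ℂ, 1 < s.re →
      ∫ x in (primePowBall (v.adicCompletion F) M)ᶜ, T s x * ((ψ (σ * (((d⁻¹ : F) : v.adicCompletion F) * x⁻¹)) : ℂ)) ∂μF = lFactor F v (chiF F E v χv) (((2 : ℕ) : ℂ) * s + 0 - 1) * Γt s :=
    fun M hM s hs => by rw [hΓ M hM s hs, hL3' s]
  -- FILE A at `Φ := N₂`, `N := N₃`, `NC`
  intro y
  exact twistedStage_half_eq_zero μF N₂ K'.isOpen hN₂K huA (frameConj_uLongTwo_coord_zero F E c hcδ v hJ₂D Q hQ) hūA (ubar_zero F E c hcδ hδ hd v hJ₂D Q hQ)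
    (frameConj_uLongTwo_coord_add F E c hcδ v hJ₂D Q hQ) (FrameTransport.frameConj F E c v (2 + 2) hJ₂D (antidiagonal_over_eq_map F E 2) Q hQ (toLocalFour F E c v (weylTwo (UnitaryGroup.LocalRing E v) (UnitaryGroup.conjLocal E c v)))) (chiF F E v χv) (norm_chiF_eq_one (F := F) (E := E) hχ) 2 0 heC (fun s => localSiegelCharacter F E c v 2 χv s (FrameTransport.frameConj F E c v (2 + 2) hJ₂D (antidiagonal_over_eq_map F E 2) Q hQ (toLocalFour F E c v (torusElt (UnitaryGroup.LocalRing E v) (UnitaryGroup.conjLocal E c v) (UnitaryGroup.conjLocal_conjLocal c v hcδ hδ) (-((Units.mk0 δ hδ).map (algebraMap E (UnitaryGroup.LocalRing E v) : E →* UnitaryGroup.LocalRing E v))⁻¹) 1))) * ((∏ w' : PlacesOver E v, ‖algebraMap E (UnitaryGroup.LocalRing E v) δ w'‖ : ℝ) : ℂ)) hrelC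
    hκ0 hword T hT' cν hνc hmψ hσ N₃ (fun s hs g => (htw s hs g).2) NC (fun s hs g => (hNC s hs g).2) hq2 (hN₂reg (1 / 2)) (hN₃reg (1 / 2)) (hNCreg (1 / 2))
    Γt N₀ hΓ' hΓreg hΓ0 hNC0 y

/-! ## ED. 2 — the Γ-letter discharged inside (★ W-FE-4): the Γ-free socket for LEVEL 2 -/

include hcδ hδ hd hT₂ hDD hQm hQ in
/-- **THE `hN₃` PRODUCER, Γ-FREE SOCKET (of record for LEVEL 2).**  Same as `localKernelN3_half_eq_zero` but WITHOUT the seven Γ binders: the evaluation letter of the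
rank-one functional equation is produced inside by ★ W-FE-4 `exists_gammaLetter` at `(ν := χ_F, e(s) = 2s, C₀(s) = χ_s(φ t(−δ⁻¹,1))·∏‖δ_w‖, κ := d⁻¹)` — `C₀` is regular and
non-zero at `½` (★ `isQRationalRegularAt_localSiegelCharacter`, ★ `isUnit_detDelta`, `δ ≠ 0`), `‖σd⁻¹‖ ∈ q^ℤ`, `e(½) = 1`.  So: ★ p862989's binders, its witnesses BY VALUE, the
conductor letter `(cν, hνc)` of `χ_F` and U1's finite clause `hU1` give **`∀ h, N₃ (1/2) h = 0`**.
[cite: KudlaRallis1994, §2] [cite: KudlaSweet1997, §1] [cite: Casselman1980, §3 Thm. 3.1] [cite: CasselmanShalika1980, §4] [cite: Tate1950, §2.5] -/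
theorem localKernelN3_half_eq_zero_of_record
    [MeasurableSpace (unipDeltaLocal F E c v 2 (JD := J₂D))] [BorelSpace (unipDeltaLocal F E c v 2 (JD := J₂D))]
    (νN : Measure (unipDeltaLocal F E c v 2 (JD := J₂D))) [νN.IsHaarMeasure]
    [MeasurableSpace (v.adicCompletion F)] [BorelSpace (v.adicCompletion F)] (μF : Measure (v.adicCompletion F)) [μF.IsAddHaarMeasure]
    (χv : ∀ w : PlacesOver E v, (w.1.adicCompletion E)ˣ →* ℂˣ) (hχ : ∀ (w' : PlacesOver E v) (x : (w'.1.adicCompletion E)ˣ), ‖((χv w' x : ℂˣ) : ℂ)‖ = 1)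
    (K₀ : Subgroup (UnitaryGroup.localPi E c (2 + 2) J₂D v))
    (hK₀ : IsCompact (K₀ : Set (UnitaryGroup.localPi E c (2 + 2) J₂D v)) ∧ IsOpen (K₀ : Set (UnitaryGroup.localPi E c (2 + 2) J₂D v)))
    (hIw : ∀ g : UnitaryGroup.localPi E c (2 + 2) J₂D v, ∃ p, IsSiegelDelta F E c hcδ hδ hd v 2 hT₂ hJ₂D p ∧ ∃ k ∈ K₀, g = p * k)
    (f : ℂ → UnitaryGroup.localPi E c (2 + 2) J₂D v → ℂ) (hSieg : ∀ s, IsLocalSiegelSection F E c hcδ hδ hd v 2 hT₂ hJ₂D χv s (f s)) (hsm : ∀ s, IsSmooth F E c v 2 (f s))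
    (hflat : ∀ s s' : ℂ, ∀ k ∈ K₀, f s k = f s' k)
    (e3 : (v.adicCompletion F × UnitaryGroup.LocalRing E v × v.adicCompletion F) ≃ₜ unipDeltaLocal F E c v 2 (JD := J₂D))
    (he3 : ∀ b₁ z b₂, ((e3 (b₁, z, b₂) : unipDeltaLocal F E c v 2 (JD := J₂D)) : UnitaryGroup.localPi E c (2 + 2) J₂D v) =
      FrameTransport.frameConj F E c v (2 + 2) hJ₂D (antidiagonal_over_eq_map F E 2) Q hQ
        (toLocalFour F E c v (nSiegel (UnitaryGroup.LocalRing E v) (UnitaryGroup.conjLocal E c v) (UnitaryGroup.conjLocal_conjLocal c v hcδ hδ)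
          (UnitaryGroup.toLocalRing E v b₁ * algebraMap E (UnitaryGroup.LocalRing E v) δ) z
          (UnitaryGroup.toLocalRing E v b₂ * algebraMap E (UnitaryGroup.LocalRing E v) δ)
          (conjLocal_coord F E c hcδ v b₁) (conjLocal_coord F E c hcδ v b₂))))
    (he3mul : ∀ p p', e3 (p + p') = e3 p * e3 p')
    (ψ : AddChar (v.adicCompletion F) Circle) (_hψ : Continuous ψ) {mψ : ℤ} (hmψ : ψ.HasConductorExp mψ) {σ : v.adicCompletion F} (hσ : σ ≠ 0)
    (w : PlacesOver E v) (hw : ∀ w' : PlacesOver E v, w' = w)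
    [MeasurableSpace (w.1.adicCompletion E)] [BorelSpace (w.1.adicCompletion E)] (μw : Measure (w.1.adicCompletion E)) [μw.IsAddHaarMeasure]
    -- ★ p862989's witnesses BY VALUE
    (A : GL (Fin 2) (UnitaryGroup.LocalRing E v)) (hA : A.val = !![1 - Pi.single w 1, Pi.single w 1; Pi.single w 1, 1 - Pi.single w 1])
    (N₁ N₂ N₃ : ℂ → UnitaryGroup.localPi E c (2 + 2) J₂D v → ℂ)
    (hN₂reg : ∀ (s₀ : ℂ) (g : UnitaryGroup.localPi E c (2 + 2) J₂D v), IsQRationalRegularAt (residueFieldCard (v.adicCompletion F)) s₀ fun s => N₂ s g)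
    (hN₃reg : ∀ (s₀ : ℂ) (g : UnitaryGroup.localPi E c (2 + 2) J₂D v), IsQRationalRegularAt (residueFieldCard (v.adicCompletion F)) s₀ fun s => N₃ s g)
    (htw : ∀ s : ℂ, 1 < s.re → ∀ h : UnitaryGroup.localPi E c (2 + 2) J₂D v,
      Integrable (fun x => conj ((ψ (σ * x) : ℂ)) * N₂ s (FrameTransport.frameConj F E c v (2 + 2) hJ₂D (antidiagonal_over_eq_map F E 2) Q hQ (toLocalFour F E c v (weylTwo (UnitaryGroup.LocalRing E v) (UnitaryGroup.conjLocal E c v))) * FrameTransport.frameConj F E c v (2 + 2) hJ₂D (antidiagonal_over_eq_map F E 2) Q hQ (toLocalFour F E c v (uLongTwo (UnitaryGroup.LocalRing E v) (UnitaryGroup.conjLocal E c v) (UnitaryGroup.toLocalRing E v x * algebraMap E (UnitaryGroup.LocalRing E v) δ) (conjLocal_coord F E c hcδ v x))) * h)) μF ∧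
        ∫ x, conj ((ψ (σ * x) : ℂ)) * N₂ s (FrameTransport.frameConj F E c v (2 + 2) hJ₂D (antidiagonal_over_eq_map F E 2) Q hQ (toLocalFour F E c v (weylTwo (UnitaryGroup.LocalRing E v) (UnitaryGroup.conjLocal E c v))) * FrameTransport.frameConj F E c v (2 + 2) hJ₂D (antidiagonal_over_eq_map F E 2) Q hQ (toLocalFour F E c v (uLongTwo (UnitaryGroup.LocalRing E v) (UnitaryGroup.conjLocal E c v) (UnitaryGroup.toLocalRing E v x * algebraMap E (UnitaryGroup.LocalRing E v) δ) (conjLocal_coord F E c hcδ v x))) * h) ∂μF = N₃ s h)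
    (hstage : ∀ s : ℂ, 1 < s.re →
      (∀ g : UnitaryGroup.localPi E c (2 + 2) J₂D v, N₁ s g = (lF F E v χv (2 * s + 1))⁻¹ * ∫ y, f s (FrameTransport.frameConj F E c v (2 + 2) hJ₂D (antidiagonal_over_eq_map F E 2) Q hQ (toLocalFour F E c v (weylTwo (UnitaryGroup.LocalRing E v) (UnitaryGroup.conjLocal E c v))) * FrameTransport.frameConj F E c v (2 + 2) hJ₂D (antidiagonal_over_eq_map F E 2) Q hQ (toLocalFour F E c v (uLongTwo (UnitaryGroup.LocalRing E v) (UnitaryGroup.conjLocal E c v) (UnitaryGroup.toLocalRing E v y * algebraMap E (UnitaryGroup.LocalRing E v) δ) (conjLocal_coord F E c hcδ v y))) * g) ∂μF) ∧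
      (∀ g : UnitaryGroup.localPi E c (2 + 2) J₂D v, N₂ s g = (lEN F E c v χv (2 * s))⁻¹ * ∫ ζ, N₁ s (FrameTransport.frameConj F E c v (2 + 2) hJ₂D (antidiagonal_over_eq_map F E 2) Q hQ (toLocalFour F E c v (leviElt (UnitaryGroup.LocalRing E v) (UnitaryGroup.conjLocal E c v) (UnitaryGroup.conjLocal_conjLocal c v hcδ hδ) A)) * FrameTransport.frameConj F E c v (2 + 2) hJ₂D (antidiagonal_over_eq_map F E 2) Q hQ (toLocalFour F E c v (uMinus (UnitaryGroup.LocalRing E v) (UnitaryGroup.conjLocal E c v) (UnitaryGroup.conjLocal_conjLocal c v hcδ hδ) (Pi.single w ζ))) * g) ∂μw))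
    -- the conductor letter of `χ_F`
    (cν : ℤ)
    (hνc : ∀ x : (v.adicCompletion F)ˣ, normAbs (v.adicCompletion F) (x : v.adicCompletion F) = 1 →
      (x : v.adicCompletion F) - 1 ∈ primePowBall (v.adicCompletion F) cν → chiF F E v χv x = 1)
    -- U1's finite clause at this family (RULING M-157q (r3); bytes of ★ (A4′-R) `normalisedRegularity`)
    (hU1 : ∀ Fn : ℂ → UnitaryGroup.localPi E c (2 + 2) J₂D v → ℂ,
      (∀ s : ℂ, 1 < s.re → ∀ h : UnitaryGroup.localPi E c (2 + 2) J₂D v,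
        localIntertwining F E c v 2 hJ₂D νN (f s) h = aNorm F E c v 2 χv (νN.real {u | (u : UnitaryGroup.localPi E c (2 + 2) J₂D v) ∈ K₀}) s * Fn s h) →
      (∀ h : UnitaryGroup.localPi E c (2 + 2) J₂D v, IsQRationalRegularAt (residueFieldCard (v.adicCompletion F)) (1 / 2) (fun s => Fn s h)) →
      ∀ h : UnitaryGroup.localPi E c (2 + 2) J₂D v, Fn (1 / 2) h = 0) :
    ∀ h : UnitaryGroup.localPi E c (2 + 2) J₂D v, N₃ (1 / 2) h = 0 := by
  -- `κ = d⁻¹ ≠ 0`, `‖σκ‖ = q^{−j_c}`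
  have hd0 : (d : F) ≠ 0 := by
    intro h0
    apply mul_ne_zero hδ hδ
    rw [hd, h0, map_zero]
  have hκ0 : ((d⁻¹ : F) : v.adicCompletion F) ≠ 0 := by
    rw [show ((d⁻¹ : F) : v.adicCompletion F) = algebraMap F (v.adicCompletion F) (d⁻¹ : F) from rfl]
    exact (map_ne_zero _).2 (inv_ne_zero hd0)
  obtain ⟨jc, hc⟩ := exists_normAbs_eq_inv_zpow (mul_ne_zero hσ hκ0)
  -- `C₀` is regular and non-zero at `½`; `e(½) = 1`
  have heC : ∀ s : ℂ, 1 < s.re → 1 < (((2 : ℕ) : ℂ) * s + 0).re := fun s hs => by simp; linarith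
  have hC₀reg : IsQRationalRegularAt (residueFieldCard (v.adicCompletion F)) (1 / 2) (fun s => localSiegelCharacter F E c v 2 χv s (FrameTransport.frameConj F E c v (2 + 2) hJ₂D (antidiagonal_over_eq_map F E 2) Q hQ (toLocalFour F E c v (torusElt (UnitaryGroup.LocalRing E v) (UnitaryGroup.conjLocal E c v) (UnitaryGroup.conjLocal_conjLocal c v hcδ hδ) (-((Units.mk0 δ hδ).map (algebraMap E (UnitaryGroup.LocalRing E v) : E →* UnitaryGroup.LocalRing E v))⁻¹) 1))) * ((∏ w' : PlacesOver E v, ‖algebraMap E (UnitaryGroup.LocalRing E v) δ w'‖ : ℝ) : ℂ)) :=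
    (isQRationalRegularAt_localSiegelCharacter F E c hcδ hδ hd v 2 hT₂ hJ₂D χv
      (isSiegelDelta_frameConj_torusElt F E c hcδ hδ hd v hT₂ hJ₂D D Dinv hDD Q hQm hQ _ 1) (1 / 2)).mul (isQRationalRegularAt_const _ _ _)
  have hC₀0 : (fun s => localSiegelCharacter F E c v 2 χv s (FrameTransport.frameConj F E c v (2 + 2) hJ₂D (antidiagonal_over_eq_map F E 2) Q hQ (toLocalFour F E c v (torusElt (UnitaryGroup.LocalRing E v) (UnitaryGroup.conjLocal E c v) (UnitaryGroup.conjLocal_conjLocal c v hcδ hδ) (-((Units.mk0 δ hδ).map (algebraMap E (UnitaryGroup.LocalRing E v) : E →* UnitaryGroup.LocalRing E v))⁻¹) 1))) * ((∏ w' : PlacesOver E v, ‖algebraMap E (UnitaryGroup.LocalRing E v) δ w'‖ : ℝ) : ℂ)) (1 / 2) ≠ 0 := by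
    have hpos : 0 < absDetDelta F E c v 2 (FrameTransport.frameConj F E c v (2 + 2) hJ₂D (antidiagonal_over_eq_map F E 2) Q hQ (toLocalFour F E c v (torusElt (UnitaryGroup.LocalRing E v) (UnitaryGroup.conjLocal E c v) (UnitaryGroup.conjLocal_conjLocal c v hcδ hδ) (-((Units.mk0 δ hδ).map (algebraMap E (UnitaryGroup.LocalRing E v) : E →* UnitaryGroup.LocalRing E v))⁻¹) 1))) :=
      Finset.prod_pos fun w' _ => norm_pos_iff.2 (K2LiuLocalSiegel.isUnit_detDelta F E c hcδ hδ hd v 2 hT₂ hJ₂D _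
        (isSiegelDelta_frameConj_torusElt F E c hcδ hδ hd v hT₂ hJ₂D D Dinv hDD Q hQm hQ _ 1) w').ne_zero
    have hprod : ((∏ w' : PlacesOver E v, ‖algebraMap E (UnitaryGroup.LocalRing E v) δ w'‖ : ℝ) : ℂ) ≠ 0 :=
      Complex.ofReal_ne_zero.2 (Finset.prod_ne_zero_iff.2 fun w' _ => norm_ne_zero_iff.2 (by rw [Pi.algebraMap_apply]; exact (map_ne_zero _).2 hδ))
    refine mul_ne_zero ?_ hprod
    unfold localSiegelCharacter
    exact mul_ne_zero (Units.ne_zero _) (Complex.cpow_ne_zero_iff.2 (Or.inl (Complex.ofReal_ne_zero.2 hpos.ne')))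
  -- the tail letter `T_s(x) = C₀(s) χ_F(x)⁻¹ ‖x‖^{−2s}` and ★ W-FE-4
  obtain ⟨T, hTdef⟩ : ∃ T : ℂ → v.adicCompletion F → ℂ, T = fun s y => (fun s => localSiegelCharacter F E c v 2 χv s (FrameTransport.frameConj F E c v (2 + 2) hJ₂D (antidiagonal_over_eq_map F E 2) Q hQ (toLocalFour F E c v (torusElt (UnitaryGroup.LocalRing E v) (UnitaryGroup.conjLocal E c v) (UnitaryGroup.conjLocal_conjLocal c v hcδ hδ) (-((Units.mk0 δ hδ).map (algebraMap E (UnitaryGroup.LocalRing E v) : E →* UnitaryGroup.LocalRing E v))⁻¹) 1))) * ((∏ w' : PlacesOver E v, ‖algebraMap E (UnitaryGroup.LocalRing E v) δ w'‖ : ℝ) : ℂ)) s *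
      Function.extend ((↑) : (v.adicCompletion F)ˣ → v.adicCompletion F)
        (fun u => (((chiF F E v χv u)⁻¹ : ℂˣ) : ℂ) * ((normAbs (v.adicCompletion F) (u : v.adicCompletion F) : ℝ) : ℂ) ^ (-(((2 : ℕ) : ℂ) * s + 0))) 0 y := ⟨_, rfl⟩
  have hT : ∀ (s : ℂ) (x : (v.adicCompletion F)ˣ), T s x =
      (fun s => localSiegelCharacter F E c v 2 χv s (FrameTransport.frameConj F E c v (2 + 2) hJ₂D (antidiagonal_over_eq_map F E 2) Q hQ (toLocalFour F E c v (torusElt (UnitaryGroup.LocalRing E v) (UnitaryGroup.conjLocal E c v) (UnitaryGroup.conjLocal_conjLocal c v hcδ hδ) (-((Units.mk0 δ hδ).map (algebraMap E (UnitaryGroup.LocalRing E v) : E →* UnitaryGroup.LocalRing E v))⁻¹) 1))) * ((∏ w' : PlacesOver E v, ‖algebraMap E (UnitaryGroup.LocalRing E v) δ w'‖ : ℝ) : ℂ)) s * (((chiF F E v χv x)⁻¹ : ℂˣ) : ℂ) * ((normAbs (v.adicCompletion F) (x : v.adicCompletion F) : ℝ) : ℂ) ^ (-(((2 : ℕ)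 : ℂ) * s + 0)) :=
    fun s x => by rw [hTdef]; simp only [Units.val_injective.extend_apply, mul_assoc]
  obtain ⟨Γt, N₀, hΓ, hΓreg, hΓ0⟩ := exists_gammaLetter μF (chiF F E v χv) (norm_chiF_eq_one (F := F) (E := E) hχ) 2 0 heC (fun s => localSiegelCharacter F E c v 2 χv s (FrameTransport.frameConj F E c v (2 + 2) hJ₂D (antidiagonal_over_eq_map F E 2) Q hQ (toLocalFour F E c v (torusElt (UnitaryGroup.LocalRing E v) (UnitaryGroup.conjLocal E c v) (UnitaryGroup.conjLocal_conjLocal c v hcδ hδ) (-((Units.mk0 δ hδ).map (algebraMap E (UnitaryGroup.LocalRing E v) : E →* UnitaryGroup.LocalRing E v))⁻¹) 1))) * ((∏ w' : PlacesOver E v, ‖algebraMap E (UnitaryGroup.LocalRing E v) δ w'‖ : ℝ) : ℂ)) T hT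
    cν hνc hmψ σ (((d⁻¹ : F) : v.adicCompletion F)) hc hC₀reg hC₀0 (by norm_num)
  -- back to FILE B's currency (`2 * s`, `lF`)
  have hL3 : ∀ s : ℂ, lFactor F v (chiF F E v χv) (((2 : ℕ) : ℂ) * s + 0 - 1) = lF F E v χv (2 * s - 1) := fun s => by
    rw [lF]; congr 1; push_cast; ring
  refine localKernelN3_half_eq_zero F E c hcδ hδ hd v hT₂ hJ₂D D Dinv hDD Q hQm hQ νN μF χv hχ K₀ hK₀ hIw f hSieg hsm hflat e3 he3 he3mul ψ _hψ hmψ hσ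
    w hw μw A hA N₁ N₂ N₃ hN₂reg hN₃reg htw hstage cν hνc T (fun s x => ?_) Γt N₀ (fun M hM s hs => ?_) hΓreg hΓ0 hU1
  · rw [hT s x]; simp only [Nat.cast_ofNat, add_zero]
  · rw [hΓ M hM s hs, hL3]

end Summit.HodgeConjecture.HodgeConjecture.Cruxes.HLiu418.K2LiuLocalKernelN3Reading

end
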